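import Mathlib
import HarnessLib
import Literature.AlgebraicGeometry.Resolution.BlowupSequencesExtensions
import Summits.ResolutionOfSingularities.ResolutionOfSingularities.Theorems.WeakOrderReduction

/-!
# ForcedTowerClasses — the forced point towers of the decomp-res node «ForcedTowers» (lens-4 g7), route-independent

Source HOME/decomp-res-lens-4/g7/ForcedTowers.lean (sha256 9d4c322bf062e089, 461 lines; critic `lean check` rc 0,
0 err, 0 warn, 0 sorry, `core_of_forced` axioms standard), CRITIC-LEDGER row 47 (2026-08-30T07:14Z): CLEARED AS
ATTACK NODE (residual 0 · decision 0 · map +1 · normal form +1).  This file carries the ROUTE-INDEPENDENT part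
verbatim (imports: Literature + the landed `Theorems.WeakOrderReduction` only), with the critic's one sharpening
applied (E₀-STRIPPING: every tower statement is rooted at a BOUNDARY-FREE datum, harmless by
`fails_iff_fails_stripped`, so «satellite» is measured against exceptional components only):
* the data class of the dim-4 pocket (`IsBase`, `IsDatum n`, `Fails`, `FailsNear`, `IsIsolatedIn`) and the TARGET
  `WOR n` (weak order reduction at marking `n`, dim ≤ 4, any boundary) with the EXACT kernel
  `wor_iff_seqDimFour_one` (`WOR n ⟺ WeakOrderReduction.SeqDimFour 1 n`);
* the NEW OBJECT `ForcedTower` (a chain of infinitely near ISOLATED top points under forced point blow-ups) and the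
  pieces `ForcedTowersTerminate n`, `NonIsolatedReduction n` (+ `NonIsolatedFailure n k`);
* the three PORTS `ForcedSeed n`, `ForcedDescent n`, `TowerObstructs n` (COSTUME(cite), KNOWN-MOD-PORT(M), counted 0
  — used as HYPOTHESES of kernels, never claimed) [BierstoneGrigorievMilmanWlodarczyk2011 §3.1–3.2; Hartshorne1977
  II.7.14/7.16];
* the König kernel `wor_of_forced` (dependent choice, PROVED), necessity `nonIsolatedReduction_of_wor` (no port),
  `forcedTowersTerminate_of_wor` (mod `TowerObstructs`), `wor_iff_pieces` (EXACT mod ports);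
* the excluded-middle leaves `Stationary{Free,Satellite}TowersTerminate n`, `GrowingTowersTerminate n` with
  `forcedTowersTerminate_iff`, `stationaryTowersTerminate_iff`, `forcedTowersTerminate_of_leaves` (PROVED).

The links BY NAME to MaxContactCut (29273 RungOne, 28011, 28544) live in `Theorems.MaxContactCutForcedTowers`.  No
statement here is a claim about resolution: definitions + proved kernels only; no instances, no notation.
-/

namespace Summit.ResolutionOfSingularities.ResolutionOfSingularities.Theorems.ForcedTowerClasses

open CategoryTheory AlgebraicGeometry
open Literature.AlgebraicGeometry.Resolution
open Summit.ResolutionOfSingularities.ResolutionOfSingularities.Theorems.WeakOrderReduction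

/-! ## The data class of the dim-4 pocket (verbatim binders of `WeakOrderReduction.SeqDimFour`) -/

/-- The ambient class: `Y → Spec k` separated, locally of finite type, quasi-compact, `Y` regular of dimension ≤ 4. -/
structure IsBase {k : Type} [Field k] (Y : Scheme.{0}) (g : Y ⟶ Spec (.of k)) : Prop where
  isSeparated : IsSeparated g
  locallyOfFiniteType : LocallyOfFiniteType g
  quasiCompact : QuasiCompact g
  isRegular : Scheme.IsRegular Y
  dim_le : topologicalKrullDim Y ≤ 4

/-- An order-bounded marked datum of marking `n`: `μ = n` and `ord_y 𝓘 ≤ n` everywhere (so `supp M = {ord = n}`);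
the boundary is arbitrary (weak resolutions ignore it: `weakResolution_congr`). -/
def IsDatum {Y : Scheme.{0}} (n : ℕ) (M : MarkedIdeal Y) : Prop :=
  M.mult = n ∧ ∀ y : Y, idealOrder M.ideal y ≤ ((n : ℕ) : ℕ∞)

/-- `M` has NO weak resolution (no weakly admissible centre sequence with empty final support). -/
def Fails {Y : Scheme.{0}} (M : MarkedIdeal Y) : Prop :=
  ¬ ∃ t : CentreSeq Y, WeakResolution t M

/-- `M` fails NEAR `y`: its restriction to every open neighbourhood of `y` has no weak resolution. -/
def FailsNear {Y : Scheme.{0}} (M : MarkedIdeal Y) (y : Y) : Prop :=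
  ∀ U : Y.Opens, y ∈ U → Fails (M.comap U.ι)

/-- `x` is an ISOLATED point of the subset `S`. -/
def IsIsolatedIn {Y : Scheme.{0}} (S : Set Y) (x : Y) : Prop :=
  x ∈ S ∧ ∃ U : Y.Opens, x ∈ U ∧ (U : Set Y) ∩ S ⊆ {x}

/-- TARGET of the node: WEAK ORDER REDUCTION at marking `n` on regular `Y/k` of dimension ≤ 4, any boundary.
`WOR n ↔ SeqDimFour 1 n` (`wor_iff_seqDimFour_one`, PROVED); `(∀ n ≥ 1, WOR n) → E 1`. -/
def WOR (n : ℕ) : Prop :=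
  ∀ p : ℕ, p.Prime → ∀ (k : Type) [Field k] [CharP k p] (Y : Scheme.{0}) (g : Y ⟶ Spec (.of k)),
    IsBase Y g → ∀ M : MarkedIdeal Y, IsDatum n M → ∃ t : CentreSeq Y, WeakResolution t M

/-! ## The new object: forced point towers -/

/-- A FORCED POINT TOWER: stages `St i`, marked ideals `D i`, CLOSED points `pt i` ISOLATED in `supp (D i)`, each `π
i : St (i+1) ⟶ St i` a blow-up of `St i` at a regular centre supported exactly at `pt i` (i.e. the reduced
point), `D (i+1)` the BGMW transform of `D i`, and `pt (i+1) ↦ pt i`.  (The minimal-counterexample normal form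
of this lens.) -/
structure ForcedTower where
  /-- the stages -/
  St : ℕ → Scheme.{0}
  /-- the marked ideals (controlled transforms) -/
  D : ∀ i, MarkedIdeal (St i)
  /-- the chain of infinitely near points -/
  pt : ∀ i, St i
  /-- the centres (reduced points) -/
  centre : ∀ i, (St i).IdealSheafData
  /-- the blow-ups -/
  π : ∀ i, St (i + 1) ⟶ St i
  isolated : ∀ i, IsIsolatedIn (D i).support (pt i)
  isClosed_pt : ∀ i, IsClosed ({pt i} : Set (St i))
  centre_support : ∀ i, ((centre i).support : Set (St i)) = {pt i}
  centre_regular : ∀ i, Scheme.IsRegular (centre i).subscheme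
  isBlowup : ∀ i, IsBlowup (π i) (centre i)
  transform_eq : ∀ i, D (i + 1) = (D i).transform (π i) (centre i)
  pt_map : ∀ i, (π i).base (pt (i + 1)) = pt i

/-- PIECE (crux, DECLARED attack piece, INSTRUMENTABLE T-forced-1): NO INFINITE FORCED POINT TOWER starts at a datum
of the class (marking `n`, dimension ≤ 4). -/
def ForcedTowersTerminate (n : ℕ) : Prop :=
  ∀ p : ℕ, p.Prime → ∀ (k : Type) [Field k] [CharP k p] (T : ForcedTower) (g : T.St 0 ⟶ Spec (.of k)),
    IsBase (T.St 0) g → IsDatum n (T.D 0) → (T.D 0).boundary = [] → False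

/-- PIECE (crux, strict sub-case of the target, INSTRUMENTABLE T-forced-2): weak order reduction for NOWHERE-ISOLATED
data — those whose support has NO isolated point. -/
def NonIsolatedReduction (n : ℕ) : Prop :=
  ∀ p : ℕ, p.Prime → ∀ (k : Type) [Field k] [CharP k p] (Y : Scheme.{0}) (g : Y ⟶ Spec (.of k)),
    IsBase Y g → ∀ M : MarkedIdeal Y, IsDatum n M → (∀ y ∈ M.support, ¬ IsIsolatedIn M.support y) →
      ∃ t : CentreSeq Y, WeakResolution t M

/-- A failing NOWHERE-ISOLATED datum (support without isolated points) over `k` exists (the negation pattern of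
`NonIsolatedReduction`). -/
def NonIsolatedFailure (n : ℕ) (k : Type) [Field k] : Prop :=
  ∃ (Y : Scheme.{0}) (g : Y ⟶ Spec (.of k)) (M : MarkedIdeal Y),
    IsBase Y g ∧ IsDatum n M ∧ Fails M ∧ ∀ y ∈ M.support, ¬ IsIsolatedIn M.support y

/-! ## Ports (COSTUME(cite) · KNOWN-MOD-PORT(M) · counted 0) -/

/-- PORT `ForcedSeed` [BGMW2011 §3.1–3.2 functoriality of blow-ups under open immersions;
`CentreSeq.transformMarked_comap`; W4.2 twin `IsoTailTowerExtractionM`]: a failing datum either yields a failing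
NOWHERE-ISOLATED datum (support without isolated points) (restrict to the complement of the finitely many isolated
support points — weak resolutions glue along a disjoint decomposition of the support) or fails near an isolated
(hence closed, `Y` being Jacobson) support point. -/
def ForcedSeed (n : ℕ) : Prop :=
  ∀ p : ℕ, p.Prime → ∀ (k : Type) [Field k] [CharP k p] (Y : Scheme.{0}) (g : Y ⟶ Spec (.of k)),
    IsBase Y g → ∀ M : MarkedIdeal Y, IsDatum n M → Fails M →
      NonIsolatedFailure n k ∨ ∃ y : Y, IsIsolatedIn M.support y ∧ IsClosed ({y} : Set Y) ∧ FailsNear M y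

/-- PORT `ForcedDescent` [forced first centre: near an isolated point `y` of `supp M` the only regular subscheme of
the support is the reduced point, so every weak resolution of the germ starts by blowing up `y` (BGMW2011 Def.
3.1.3); class preservation (blow-up of a regular `Y` at a closed point is regular, separated, of finite type,
dimension ≤ 4: Hartshorne II.7.16, II.8.24); order non-increase of the controlled transform under a blow-up at a
point of order exactly `n` (BGMW2011 Lemma 3.2.2 / Hironaka); then `ForcedSeed`'s gluing on the blow-up; W4.2
twin `IsoStepCentreGermM`]: a datum failing near an isolated closed point either yields a failing
NOWHERE-ISOLATED datum (support without isolated points) or a FORCED SUCCESSOR — the blow-up at the reduced `y`,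
the transform again in the class, failing near an isolated closed point `y' ↦ y`. -/
def ForcedDescent (n : ℕ) : Prop :=
  ∀ p : ℕ, p.Prime → ∀ (k : Type) [Field k] [CharP k p] (Y : Scheme.{0}) (g : Y ⟶ Spec (.of k)),
    IsBase Y g → ∀ M : MarkedIdeal Y, IsDatum n M → ∀ y : Y, IsIsolatedIn M.support y →
      IsClosed ({y} : Set Y) → FailsNear M y →
      NonIsolatedFailure n k ∨
        ∃ (C : Y.IdealSheafData) (Y' : Scheme.{0}) (π : Y' ⟶ Y) (g' : Y' ⟶ Spec (.of k)) (y' : Y'),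
          (C.support : Set Y) = {y} ∧ Scheme.IsRegular C.subscheme ∧ IsBlowup π C ∧ IsBase Y' g' ∧
            IsDatum n (M.transform π C) ∧ π.base y' = y ∧ IsIsolatedIn (M.transform π C).support y' ∧
            IsClosed ({y'} : Set Y') ∧ FailsNear (M.transform π C) y'

/-- PORT `TowerObstructs` [centre counting: a weak resolution `t` of `D 0` must, near the isolated point `pt 0`, begin
with the reduced point `pt 0`; over it the stage and the transform agree with `(St 1, D 1)` (universal property
`IsBlowup`), so `t` must later blow up `pt 1`, … — `t` would need infinitely many centres; BGMW2011 §3, Hartshorne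
II.7.14]: a datum carrying an infinite forced tower has no weak resolution. -/
def TowerObstructs (n : ℕ) : Prop :=
  ∀ p : ℕ, p.Prime → ∀ (k : Type) [Field k] [CharP k p] (T : ForcedTower) (g : T.St 0 ⟶ Spec (.of k)),
    IsBase (T.St 0) g → IsDatum n (T.D 0) → Fails (T.D 0)

/-! ## Kernel 1 (PROVED, no port): weak resolutions ignore the boundary -/

/-- Weak admissibility and the transformed `(𝓘, μ)` depend only on `(𝓘, μ)`, not on the boundary. [folklore] -/
theorem weakAdmissible_congr : ∀ {X : Scheme.{0}} (s : CentreSeq X) (M M' : MarkedIdeal X),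
    M.ideal = M'.ideal → M.mult = M'.mult →
      (WeakAdmissible s M ↔ WeakAdmissible s M') ∧ (s.transformMarked M).ideal = (s.transformMarked M').ideal ∧
        (s.transformMarked M).mult = (s.transformMarked M').mult
  | _, .nil _, M, M', hI, hμ => by
      refine ⟨?_, ?_, ?_⟩
      · simp [WeakAdmissible]
      · simpa [CentreSeq.transformMarked] using hI
      · simpa [CentreSeq.transformMarked] using hμ
  | _, .cons C rest, M, M', hI, hμ => by
      have hs : M.support = M'.support := by
        simp only [MarkedIdeal.support, hI, hμ]
      have ht : (M.transform (blowup.π C) C).ideal = (M'.transform (blowup.π C) C).ideal := by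
        simp only [MarkedIdeal.transform_ideal, hI, hμ]
      have hm : (M.transform (blowup.π C) C).mult = (M'.transform (blowup.π C) C).mult := by
        simp only [MarkedIdeal.transform_mult, hμ]
      obtain ⟨h1, h2, h3⟩ := weakAdmissible_congr rest _ _ ht hm
      refine ⟨?_, ?_, ?_⟩
      · simp only [WeakAdmissible, hs, h1]
      · simpa [CentreSeq.transformMarked] using h2
      · simpa [CentreSeq.transformMarked] using h3

/-- Weak resolutions depend only on `(𝓘, μ)`, not on the boundary `E`. [folklore] -/
theorem weakResolution_congr {X : Scheme.{0}} (s : CentreSeq X) (M M' : MarkedIdeal X) (hI : M.ideal = M'.ideal)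
    (hμ : M.mult = M'.mult) : WeakResolution s M ↔ WeakResolution s M' := by
  obtain ⟨h1, h2, h3⟩ := weakAdmissible_congr s M M' hI hμ
  have hs : (s.transformMarked M).support = (s.transformMarked M').support := by
    simp only [MarkedIdeal.support, h2, h3]
  simp only [WeakResolution, h1, hs]

/-- `BoundaryIrrelevant` as a closed statement (PROVED). [folklore] -/
theorem fails_iff_fails_stripped {X : Scheme.{0}} (M : MarkedIdeal X) :
    Fails M ↔ Fails (⟨M.ideal, [], M.mult⟩ : MarkedIdeal X) := by
  simp only [Fails, not_iff_not]
  exact exists_congr fun s => weakResolution_congr s M _ rfl rfl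

/-! ## Kernel 2 (PROVED): the target is `SeqDimFour 1 n` exactly -/

/-- `WOR n ⟹ SeqDimFour 1 n` (take the empty boundary). [folklore] -/
theorem seqDimFour_one_of_wor {n : ℕ} (h : WOR n) : SeqDimFour 1 n := by
  intro p hp k _ _ Y g hs hl hq hY hdim I hord _
  exact h p hp k Y g ⟨hs, hl, hq, hY, hdim⟩ ⟨I, [], n⟩ ⟨rfl, hord⟩

/-- `SeqDimFour 1 n ⟹ WOR n` (weak resolutions ignore the boundary). [folklore] -/
theorem wor_of_seqDimFour_one {n : ℕ} (h : SeqDimFour 1 n) : WOR n := by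
  intro p hp k _ _ Y g hB M hM
  obtain ⟨hμ, hord⟩ := hM
  obtain ⟨t, ht⟩ := h p hp k Y g hB.isSeparated hB.locallyOfFiniteType hB.quasiCompact hB.isRegular hB.dim_le M.ideal
    hord (fun y _ => Or.inl le_rfl)
  exact ⟨t, (weakResolution_congr t M ⟨M.ideal, [], n⟩ rfl hμ).2 ht⟩

/-- **EXACT: `WOR n ⟺ SeqDimFour 1 n`.** [folklore] -/
theorem wor_iff_seqDimFour_one (n : ℕ) : WOR n ↔ SeqDimFour 1 n :=
  ⟨seqDimFour_one_of_wor, wor_of_seqDimFour_one⟩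

/-! ## Kernel 3 (PROVED, dependent choice): the König normal form — towers ∧ nowhere-isolated data ⟹ target -/

section Konig

variable {n : ℕ} {k : Type} [Field k]

/-- A pointed failing datum (node of the forced forest). -/
structure Node (n : ℕ) (k : Type) [Field k] where
  Y : Scheme.{0}
  g : Y ⟶ Spec (.of k)
  base : IsBase Y g
  M : MarkedIdeal Y
  datum : IsDatum n M
  y : Y
  isolated : IsIsolatedIn M.support y
  closed : IsClosed ({y} : Set Y)
  fails : FailsNear M y

/-- A forced successor of a node together with the connecting blow-up. -/
structure Succ (N : Node n k) where
  next : Node n k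
  centre : N.Y.IdealSheafData
  π : next.Y ⟶ N.Y
  centre_support : (centre.support : Set N.Y) = {N.y}
  centre_regular : Scheme.IsRegular centre.subscheme
  isBlowup : IsBlowup π centre
  transform_eq : next.M = N.M.transform π centre
  pt_map : π.base next.y = N.y

/-- Iterating a successor function from a root node. -/
noncomputable def nodes (S : ∀ N : Node n k, Succ N) (N₀ : Node n k) : ℕ → Node n k :=
  fun i => Nat.rec N₀ (fun _ N => (S N).next) i

/-- The forced tower of an iterated successor function. -/
noncomputable def towerOf (S : ∀ N : Node n k, Succ N) (N₀ : Node n k) : ForcedTower where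
  St i := (nodes S N₀ i).Y
  D i := (nodes S N₀ i).M
  pt i := (nodes S N₀ i).y
  centre i := (S (nodes S N₀ i)).centre
  π i := (S (nodes S N₀ i)).π
  isolated i := (nodes S N₀ i).isolated
  isClosed_pt i := (nodes S N₀ i).closed
  centre_support i := (S (nodes S N₀ i)).centre_support
  centre_regular i := (S (nodes S N₀ i)).centre_regular
  isBlowup i := (S (nodes S N₀ i)).isBlowup
  transform_eq i := (S (nodes S N₀ i)).transform_eq
  pt_map i := (S (nodes S N₀ i)).pt_map

end Konig

/-- **König kernel** (PROVED modulo the two descent ports): no infinite forced tower (rooted at a boundary-free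
datum — the E₀-stripping of CRITIC row 47, harmless by `fails_iff_fails_stripped`) ∧ nowhere-isolated reduction
⟹ weak order reduction at marking `n`. [folklore] -/
theorem wor_of_forced {n : ℕ} (hS : ForcedSeed n) (hD : ForcedDescent n) (hQ : ForcedTowersTerminate n)
    (hN : NonIsolatedReduction n) : WOR n := by
  intro p hp k _ _ Y g hB M hM
  by_contra hfail
  have hM' : IsDatum n (⟨M.ideal, [], M.mult⟩ : MarkedIdeal Y) := hM
  have hfail' : Fails (⟨M.ideal, [], M.mult⟩ : MarkedIdeal Y) := (fails_iff_fails_stripped M).1 hfail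
  have hnc : ¬ NonIsolatedFailure n k := fun ⟨Y', g', M', hB', hM'', hf', hni'⟩ =>
    hf' (hN p hp k Y' g' hB' M' hM'' hni')
  obtain ⟨y, hy, hyc, hyf⟩ := (hS p hp k Y g hB _ hM' hfail').resolve_left hnc
  let N₀ : Node n k := ⟨Y, g, hB, ⟨M.ideal, [], M.mult⟩, hM', y, hy, hyc, hyf⟩
  have step : ∀ N : Node n k, Nonempty (Succ N) := fun N => by
    obtain ⟨C, Y', π, g', y', hC, hreg, hbl, hB', hM'', hpt, hiso, hcl, hf⟩ :=
      (hD p hp k N.Y N.g N.base N.M N.datum N.y N.isolated N.closed N.fails).resolve_left hnc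
    exact ⟨⟨⟨Y', g', hB', N.M.transform π C, hM'', y', hiso, hcl, hf⟩, C, π, hC, hreg, hbl, rfl, hpt⟩⟩
  let S : ∀ N : Node n k, Succ N := fun N => Classical.choice (step N)
  exact hQ p hp k (towerOf S N₀) (nodes S N₀ 0).g (nodes S N₀ 0).base (nodes S N₀ 0).datum rfl

/-! ## Kernel 4: necessity of the pieces (the cut is EXACT modulo `TowerObstructs`) -/

/-- PROVED, no port: the nowhere-isolated piece is a sub-case of the target. [folklore] -/
theorem nonIsolatedReduction_of_wor {n : ℕ} (h : WOR n) : NonIsolatedReduction n :=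
  fun p hp k _ _ Y g hB M hM _ => h p hp k Y g hB M hM

/-- Modulo the counting port: the target forbids infinite forced towers. [folklore] -/
theorem forcedTowersTerminate_of_wor {n : ℕ} (hT : TowerObstructs n) (h : WOR n) : ForcedTowersTerminate n :=
  fun p hp k _ _ T g hB hD _ => hT p hp k T g hB hD (h p hp k (T.St 0) g hB (T.D 0) hD)

/-- EXACTNESS of the node modulo the ports. [folklore] -/
theorem wor_iff_pieces {n : ℕ} (hS : ForcedSeed n) (hD : ForcedDescent n) (hT : TowerObstructs n) :
    WOR n ↔ ForcedTowersTerminate n ∧ NonIsolatedReduction n :=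
  ⟨fun h => ⟨forcedTowersTerminate_of_wor hT h, nonIsolatedReduction_of_wor h⟩, fun h => wor_of_forced hS hD h.1 h.2⟩

/-! ## Kernel 5 (PROVED, excluded middle): the residue-field cut and the free/satellite cut of the tower piece -/

/-- The residue fields `k(pt i)` are eventually constant along the tower. -/
def ForcedTower.EventuallyStationary (T : ForcedTower) : Prop :=
  ∃ i₀ : ℕ, ∀ i, i₀ ≤ i → IsIso ((T.π i).residueFieldMap (T.pt (i + 1)))

/-- `pt (i+1)` is a SATELLITE point: it lies on (the strict transform of) an older boundary component. -/
def ForcedTower.Satellite (T : ForcedTower) (i : ℕ) : Prop :=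
  ∃ B ∈ (T.D (i + 1)).boundary.dropLast, T.pt (i + 1) ∈ (B.support : Set (T.St (i + 1)))

/-- The tower is eventually FREE (finitely many satellite points). -/
def ForcedTower.EventuallyFree (T : ForcedTower) : Prop :=
  ∃ i₀ : ℕ, ∀ i, i₀ ≤ i → ¬ T.Satellite i

/-- Sub-piece: residually stationary forced towers terminate. -/
def StationaryTowersTerminate (n : ℕ) : Prop :=
  ∀ p : ℕ, p.Prime → ∀ (k : Type) [Field k] [CharP k p] (T : ForcedTower) (g : T.St 0 ⟶ Spec (.of k)),
    IsBase (T.St 0) g → IsDatum n (T.D 0) → (T.D 0).boundary = [] → T.EventuallyStationary → False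

/-- Sub-piece (the p-CORE lives in its inseparable part): residually GROWING forced towers terminate. -/
def GrowingTowersTerminate (n : ℕ) : Prop :=
  ∀ p : ℕ, p.Prime → ∀ (k : Type) [Field k] [CharP k p] (T : ForcedTower) (g : T.St 0 ⟶ Spec (.of k)),
    IsBase (T.St 0) g → IsDatum n (T.D 0) → (T.D 0).boundary = [] → ¬ T.EventuallyStationary → False

/-- Sub-piece (DECIDED-MOD-PORT, arc argument; tree twin K1): stationary eventually-free towers terminate. -/
def StationaryFreeTowersTerminate (n : ℕ) : Prop :=
  ∀ p : ℕ, p.Prime → ∀ (k : Type) [Field k] [CharP k p] (T : ForcedTower) (g : T.St 0 ⟶ Spec (.of k)),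
    IsBase (T.St 0) g → IsDatum n (T.D 0) → (T.D 0).boundary = [] → T.EventuallyStationary → T.EventuallyFree → False

/-- Sub-piece (OPEN, IDEA-NEEDED; tree twin K2/K3): stationary satellite-recurrent towers terminate. -/
def StationarySatelliteTowersTerminate (n : ℕ) : Prop :=
  ∀ p : ℕ, p.Prime → ∀ (k : Type) [Field k] [CharP k p] (T : ForcedTower) (g : T.St 0 ⟶ Spec (.of k)),
    IsBase (T.St 0) g → IsDatum n (T.D 0) → (T.D 0).boundary = [] → T.EventuallyStationary → ¬ T.EventuallyFree →
      False

/-- **EXACT by excluded middle: towers ⟺ stationary ∧ growing.** [folklore] -/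
theorem forcedTowersTerminate_iff (n : ℕ) :
    ForcedTowersTerminate n ↔ StationaryTowersTerminate n ∧ GrowingTowersTerminate n := by
  constructor
  · intro h
    exact ⟨fun p hp k _ _ T g hB hD hE _ => h p hp k T g hB hD hE,
      fun p hp k _ _ T g hB hD hE _ => h p hp k T g hB hD hE⟩
  · rintro ⟨hs, hg⟩ p hp k _ _ T g hB hD hE
    by_cases hT : T.EventuallyStationary
    · exact hs p hp k T g hB hD hE hT
    · exact hg p hp k T g hB hD hE hT

/-- **EXACT by excluded middle: stationary ⟺ free ∧ satellite.** [folklore] -/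
theorem stationaryTowersTerminate_iff (n : ℕ) :
    StationaryTowersTerminate n ↔ StationaryFreeTowersTerminate n ∧ StationarySatelliteTowersTerminate n := by
  constructor
  · intro h
    exact ⟨fun p hp k _ _ T g hB hD hE hs _ => h p hp k T g hB hD hE hs,
      fun p hp k _ _ T g hB hD hE hs _ => h p hp k T g hB hD hE hs⟩
  · rintro ⟨hf, hsat⟩ p hp k _ _ T g hB hD hE hs
    by_cases hT : T.EventuallyFree
    · exact hf p hp k T g hB hD hE hs hT
    · exact hsat p hp k T g hB hD hE hs hT

/-- The full leaf list of the tower piece. [folklore] -/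
theorem forcedTowersTerminate_of_leaves {n : ℕ} (h₁ : StationaryFreeTowersTerminate n)
    (h₂ : StationarySatelliteTowersTerminate n) (h₃ : GrowingTowersTerminate n) : ForcedTowersTerminate n :=
  (forcedTowersTerminate_iff n).2 ⟨(stationaryTowersTerminate_iff n).2 ⟨h₁, h₂⟩, h₃⟩

end Summit.ResolutionOfSingularities.ResolutionOfSingularities.Theorems.ForcedTowerClasses
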